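import Mathlib

/-!
# SEIL-F outer end: the frozen-coefficient polar closure in closed form (Riccati)
(solo-blind s87, kernel #200; PLAN §109 (j))

Along a FROZEN clock (`κ = P h` constant — the leading order at lags `ℓ ≪ 1`, i.e. the `P → ∞` scaling
regime of LEMMA R) the closure ODEs of kernels #195/#198,
  `a' = iκ - 4K₀ a²`,  `p' = -4K₀ a p`,  `(c²)' = 2K₀ (p² - 2a) c²`,
are solved in closed form: with `A, ω` such that `ω = 4K₀A`, `A ω = iκ` (so `A = at_∞ = √(iκ/4K₀)`),
  `a(ℓ) = A tanh(ωℓ)`,  `p(ℓ) = p₀ / cosh(ωℓ)`,  `c(ℓ)² = c₀² exp(2K₀ p₀² tanh(ωℓ)/ω) / cosh(ωℓ)`.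
Consequences used in the asymptotics: the cap width saturates at `|A|^{-1/2} ∝ (P|h|)^{-1/4}`, the cap
amplitude decays at rate `Re ω / 2 ∝ (P|h|)^{1/2}`, and the datum wavenumber `p₀ = ±im` leaves the finite
survival factor `exp(-m²/(4A))` (`2K₀p₀²/ω = -m²/(2A)`·tanh → `-m²/(2A)`, halved for `c`).
All statements are `HasDerivAt` identities in `ℓ : ℝ` with values in `ℂ`, under `cosh(ωℓ) ≠ 0`.
-/

namespace Summit.AnomalousDissipation.AnomalousDissipation.Theorems

open Complex

/-- `ℓ ↦ cosh(ωℓ)` has derivative `ω sinh(ωℓ)`. -/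
theorem hasDerivAt_cosh_mul (ω : ℂ) (l : ℝ) :
    HasDerivAt (fun t : ℝ => cosh (ω * t)) (ω * sinh (ω * l)) l := by
  have hlin : HasDerivAt (fun z : ℂ => ω * z) ω (l : ℂ) := by
    simpa using (hasDerivAt_id (l : ℂ)).const_mul ω
  have h := ((Complex.hasDerivAt_cosh (ω * l)).comp (l : ℂ) hlin).comp_ofReal
  exact h.congr_deriv (by ring)

/-- `ℓ ↦ sinh(ωℓ)` has derivative `ω cosh(ωℓ)`. -/
theorem hasDerivAt_sinh_mul (ω : ℂ) (l : ℝ) :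
    HasDerivAt (fun t : ℝ => sinh (ω * t)) (ω * cosh (ω * l)) l := by
  have hlin : HasDerivAt (fun z : ℂ => ω * z) ω (l : ℂ) := by
    simpa using (hasDerivAt_id (l : ℂ)).const_mul ω
  have h := ((Complex.hasDerivAt_sinh (ω * l)).comp (l : ℂ) hlin).comp_ofReal
  exact h.congr_deriv (by ring)

/-- The frozen cap width: `a(ℓ) = A tanh(ωℓ) = A sinh(ωℓ)/cosh(ωℓ)`. -/
noncomputable def riccatiA (A ω : ℂ) (l : ℝ) : ℂ := A * sinh (ω * l) / cosh (ω * l)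

/-- The frozen datum wavenumber: `p(ℓ) = p₀ / cosh(ωℓ)`. -/
noncomputable def riccatiP (p₀ ω : ℂ) (l : ℝ) : ℂ := p₀ / cosh (ω * l)

/-- The frozen squared amplitude: `c(ℓ)² = W₀ exp(2K₀ p₀² sinh(ωℓ)/(ω cosh(ωℓ))) / cosh(ωℓ)`. -/
noncomputable def riccatiW (W₀ K₀ p₀ ω : ℂ) (l : ℝ) : ℂ :=
  W₀ * cexp (2 * K₀ * p₀ ^ 2 * sinh (ω * l) / (ω * cosh (ω * l))) / cosh (ω * l)

/-- RICCATI: `a = A tanh(ωℓ)` solves `a' = iκ - 4K₀a²` when `ω = 4K₀A`, `Aω = iκ`. -/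
theorem riccatiA_solves (A ω K₀ κ : ℂ) (l : ℝ) (hω : ω = 4 * K₀ * A) (hAω : A * ω = I * κ)
    (hc : cosh (ω * l) ≠ 0) :
    HasDerivAt (riccatiA A ω) (I * κ - 4 * K₀ * riccatiA A ω l ^ 2) l := by
  subst hω
  unfold riccatiA
  have hs := hasDerivAt_sinh_mul (4 * K₀ * A) l
  have hch := hasDerivAt_cosh_mul (4 * K₀ * A) l
  have h := (hs.const_mul A).div hch hc
  refine h.congr_deriv ?_
  rw [← hAω]
  generalize hC : cosh (4 * K₀ * A * (l : ℂ)) = C at hc ⊢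
  generalize hS : sinh (4 * K₀ * A * (l : ℂ)) = S
  field_simp

/-- `p = p₀ / cosh(ωℓ)` solves `p' = -4K₀ a p` with `a = A tanh(ωℓ)`, `ω = 4K₀A`. -/
theorem riccatiP_solves (A ω K₀ p₀ : ℂ) (l : ℝ) (hω : ω = 4 * K₀ * A) (hc : cosh (ω * l) ≠ 0) :
    HasDerivAt (riccatiP p₀ ω) (-4 * K₀ * riccatiA A ω l * riccatiP p₀ ω l) l := by
  subst hω
  unfold riccatiP riccatiA
  have hch := hasDerivAt_cosh_mul (4 * K₀ * A) l
  have h := (hasDerivAt_const l p₀).div hch hc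
  refine h.congr_deriv ?_
  generalize hC : cosh (4 * K₀ * A * (l : ℂ)) = C at hc ⊢
  generalize hS : sinh (4 * K₀ * A * (l : ℂ)) = S
  field_simp
  ring

/-- `W = c²` in closed form solves `W' = 2K₀ (p² - 2a) W` with `a, p` as above (`ω = 4K₀A`, `ω ≠ 0`);
the identity `cosh² - sinh² = 1` enters through the derivative of the exponent `tanh(ωℓ)/ω`. -/
theorem riccatiW_solves (A ω K₀ p₀ W₀ : ℂ) (l : ℝ) (hω : ω = 4 * K₀ * A) (hω0 : ω ≠ 0)
    (hc : cosh (ω * l) ≠ 0) :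
    HasDerivAt (riccatiW W₀ K₀ p₀ ω)
      (2 * K₀ * (riccatiP p₀ ω l ^ 2 - 2 * riccatiA A ω l) * riccatiW W₀ K₀ p₀ ω l) l := by
  subst hω
  unfold riccatiW riccatiP riccatiA
  have hs := hasDerivAt_sinh_mul (4 * K₀ * A) l
  have hch := hasDerivAt_cosh_mul (4 * K₀ * A) l
  have hden : HasDerivAt (fun t : ℝ => 4 * K₀ * A * cosh (4 * K₀ * A * t))
      (4 * K₀ * A * (4 * K₀ * A * sinh (4 * K₀ * A * l))) l := hch.const_mul (4 * K₀ * A)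
  have hden0 : 4 * K₀ * A * cosh (4 * K₀ * A * l) ≠ 0 := mul_ne_zero hω0 hc
  have h1 : cosh (4 * K₀ * A * l) ^ 2 - sinh (4 * K₀ * A * l) ^ 2 = 1 :=
    Complex.cosh_sq_sub_sinh_sq (4 * K₀ * A * l)
  have hE := (hs.const_mul (2 * K₀ * p₀ ^ 2)).div hden hden0
  have hE2 : HasDerivAt (fun t : ℝ => 2 * K₀ * p₀ ^ 2 * sinh (4 * K₀ * A * t) / (4 * K₀ * A * cosh (4 * K₀ * A * t)))
      (2 * K₀ * p₀ ^ 2 * (4 * K₀ * A) ^ 2 / (4 * K₀ * A * cosh (4 * K₀ * A * l)) ^ 2) l := by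
    refine hE.congr_deriv ?_
    congr 1
    linear_combination (2 * K₀ * p₀ ^ 2 * (4 * K₀ * A) ^ 2) * h1
  have hexp := hE2.cexp
  have hnum := hexp.const_mul W₀
  have h := hnum.div hch hc
  refine h.congr_deriv ?_
  generalize hC : cosh (4 * K₀ * A * (l : ℂ)) = C at hc ⊢
  generalize hS : sinh (4 * K₀ * A * (l : ℂ)) = S
  have hA : A ≠ 0 := by
    intro hA0; apply hω0; rw [hA0]; ring
  have hK : K₀ ≠ 0 := by
    intro hK0; apply hω0; rw [hK0]; ring
  field_simp
  ring

/-- Initial values: `a(0) = 0`, `p(0) = p₀`, `W(0) = W₀`. -/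
theorem riccati_initial (A ω K₀ p₀ W₀ : ℂ) :
    riccatiA A ω 0 = 0 ∧ riccatiP p₀ ω 0 = p₀ ∧ riccatiW W₀ K₀ p₀ ω 0 = W₀ := by
  unfold riccatiA riccatiP riccatiW
  simp

end Summit.AnomalousDissipation.AnomalousDissipation.Theorems
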